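import Summits.CriticalPhenomena.CardyFormulaZ2.Theses.CardyGluingRDE
import Literature.Probability.Percolation.QuadCrossingDiscreteGluingGarban

/-!
# Route `CardyGluingRDE`, item `FourArmBeyondOne` (stmt-CriticalPhenomena-8579): proved

The gate fact of route `CriticalPhenomena/CardyGluingRDE`: for critical bond percolation on `ℤ²`
there are `ε > 0` and `c > 0` with `P_{1/2}[fourArmTwoClusters m n] ≤ c (m/n)^{1+ε}` for all
`1 ≤ m ≤ n` (the polychromatic four-arm exponent exceeds one, `α₄ ≥ 1 + α₂/2 > 1`).

Everything is already proved in the tree (Literature/Probability/Percolation):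
* `Garban2011_fourArm_multiscale_holds` (`FourArmGarbanHolds.lean`) — Garban's multi-scale bound
  (Schramm–Smirnov 2011, Appendix B, Lemma B.1; van den Berg–Nolin 2020, Lemma 8), conditional on a
  polychromatic two-arm bound `π₂(m,n) ≤ c'(m/n)^{2ε}`;
* `real_sqAnnulusOpenCrossing_le_rpow_of_le_half` (`ZdFourArmAPrioriLowerBound.lean`) — the RSW
  one-arm bound `π₁(m,n) ≤ C (m/n)^α` at `p ≤ 1/2`, whence `π₂ ≤ π₁ ≤ C (m/n)^α`;
* their combination `QuadCrossing.fourArm_bound` (`QuadCrossingDiscreteGluingGarban.lean`):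
  `∃ c ε, 0 < c ∧ 0 < ε ∧ ∀ 1 ≤ m ≤ n, π₄(m,n) ≤ c (m/n)^{1+ε}`.
The route item is that statement with the two existentials in the other order.
-/

namespace Summit.CriticalPhenomena.CardyFormulaZ2.Theorems

/-- **`FourArmBeyondOne` holds** (item stmt-CriticalPhenomena-8579 of route `CardyGluingRDE`):
critical bond percolation on `ℤ²` satisfies `P_{1/2}[fourArmTwoClusters m n] ≤ c (m/n)^{1+ε}` for
some `ε > 0`, `c > 0` and all `1 ≤ m ≤ n` — Garban's multi-scale four-arm bound (proved in tree,
`Garban2011_fourArm_multiscale_holds`) with its RSW two-arm input discharged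
(`QuadCrossing.fourArm_bound`). [cite: SchrammSmirnov2011, Appendix B (Garban), Lemma B.1]
[cite: VandenbergNolin2020, Lemma 8] -/
theorem FourArmBeyondOne_proof :
    Summit.CriticalPhenomena.CardyFormulaZ2.Theses.CardyGluingRDE.FourArmBeyondOne := by
  unfold Summit.CriticalPhenomena.CardyFormulaZ2.Theses.CardyGluingRDE.FourArmBeyondOne
  obtain ⟨c, ε, hc, hε, h⟩ := Literature.Probability.Percolation.QuadCrossing.fourArm_bound
  exact ⟨ε, hε, c, hc, h⟩

end Summit.CriticalPhenomena.CardyFormulaZ2.Theorems
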